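import Summits.Ventures.PercRepro.C026CutVertexB2

/-!
# mine-3's Theorem B (B1): a mark-free side of a cut vertex is a free factor (p5, gen 15)

mine-3 (`proofs/MINE3-BLOCKS.md` §1 (B1), §2): if the side `false` of the cut vertex `v` contains no mark,
`Δ_CF(G) = 2^{|E(G₂)|} · Δ_CF(G₁)` — a path between marks never enters `G₂`, and `G₂` only adds non-marks to the
closed cluster of `c`, so every event depends on the side-`true` configuration alone (**`slackCF_cut_free`**).
-/

namespace PercRepro

open Finset

namespace MultiGraph

section CutVertexB1

variable {V E : Type*} {G : MultiGraph V E}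

open Classical in
/-- A cell of `G` whose marks all lie on side `true` counts as the side-`true` cell times the free side. -/
theorem card_cell_cut_free [Fintype E] {v : V} {side : E → Bool} (hg : G.IsGluing v v v side)
    (P : (Config E → Prop)) (P₁ : Config {e // side e = true} → Prop)
    (hP : ∀ ω, P ω ↔ P₁ (sideRestrict ω side true)) :
    (univ.filter P).card = (univ.filter P₁).card * 2 ^ Fintype.card {e // side e = false} := by
  have h2 : (univ.filter fun _ : Config {e // side e = false} => True).card =
      2 ^ Fintype.card {e // side e = false} := by
    rw [Finset.filter_true_of_mem (fun _ _ => trivial), Finset.card_univ, Fintype.card_fun,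
      Fintype.card_bool]
  rw [← h2]
  have e1 : (univ.filter P) = (univ.filter fun ω : Config E =>
      P₁ (sideRestrict ω side true) ∧ (fun _ : Config {e // side e = false} => True)
        (sideRestrict ω side false)) :=
    Finset.filter_congr fun ω _ => by simp only [hP ω, and_true]
  rw [e1]
  have := hg
  convert card_filter_cut side P₁ (fun _ : Config {e // side e = false} => True) using 4

open Classical in
/-- **THEOREM B (B1)**: `Δ_CF(G) = 2^{|E(G₂)|} · Δ_CF(G₁)` when all three marks lie on side `true` of the cut
vertex `v` (or are `v` itself). -/
theorem slackCF_cut_free [Fintype E] {v : V} {side : E → Bool} (hg : G.IsGluing v v v side) {a b c : V}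
    (ha : a = v ∨ G.OnSide side true a) (hb : b = v ∨ G.OnSide side true b)
    (hc : c = v ∨ G.OnSide side true c) :
    G.slackCF a b c = 2 ^ Fintype.card {e // side e = false} * (G.part side true).slackCF a b c := by
  have htf : true ≠ false := by decide
  have d : ∀ (x y : V), (x = v ∨ G.OnSide side true x) → (y = v ∨ G.OnSide side true y) →
      ∀ ω : Config E, G.Conn ω x y ↔ (G.part side true).Conn (sideRestrict ω side true) x y :=
    fun x y hx hy ω => conn_cut_iff_same hg htf hx hy ω
  have h1 := card_cell_cut_free hg (fun ω : Config E => G.Conn ω a b ∧ ¬ G.Conn ω a c)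
    (fun ω₁ => (G.part side true).Conn ω₁ a b ∧ ¬ (G.part side true).Conn ω₁ a c)
    (fun ω => by rw [d a b ha hb, d a c ha hc])
  have h2 := card_cell_cut_free hg (fun ω : Config E => G.Conn ω c a ∧ ¬ G.Conn ω c b)
    (fun ω₁ => (G.part side true).Conn ω₁ c a ∧ ¬ (G.part side true).Conn ω₁ c b)
    (fun ω => by rw [d c a hc ha, d c b hc hb])
  have h3 := card_cell_cut_free hg (fun ω : Config E => G.Conn ω c b ∧ ¬ G.Conn ω c a)
    (fun ω₁ => (G.part side true).Conn ω₁ c b ∧ ¬ (G.part side true).Conn ω₁ c a)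
    (fun ω => by rw [d c b hc hb, d c a hc ha])
  have h4 := card_cell_cut_free hg
    (fun ω : Config E => G.Conn ω a b ∧ ¬ G.Conn ωᶜ c a ∧ ¬ G.Conn ωᶜ c b)
    (fun ω₁ => (G.part side true).Conn ω₁ a b ∧ ¬ (G.part side true).Conn ω₁ᶜ c a ∧
      ¬ (G.part side true).Conn ω₁ᶜ c b)
    (fun ω => by rw [d a b ha hb, d c a hc ha, d c b hc hb, sideRestrict_compl])
  have key : ∀ (A₁ A₂ A₃ A₄ B₁ B₂ B₃ B₄ M : ℤ), A₁ = B₁ * M → A₂ = B₂ * M → A₃ = B₃ * M →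
      A₄ = B₄ * M → A₁ + A₂ + A₃ - A₄ = M * (B₁ + B₂ + B₃ - B₄) := by
    intros
    subst_vars
    ring
  unfold slackCF
  refine key _ _ _ _ _ _ _ _ _ ?_ ?_ ?_ ?_
  · have := congrArg (fun n : ℕ => (n : ℤ)) h1
    push_cast at this
    convert this using 10
    repeat first | rfl | exact Subsingleton.elim _ _ | congr 1
  · have := congrArg (fun n : ℕ => (n : ℤ)) h2
    push_cast at this
    convert this using 10
    repeat first | rfl | exact Subsingleton.elim _ _ | congr 1
  · have := congrArg (fun n : ℕ => (n : ℤ)) h3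
    push_cast at this
    convert this using 10
    repeat first | rfl | exact Subsingleton.elim _ _ | congr 1
  · have := congrArg (fun n : ℕ => (n : ℤ)) h4
    push_cast at this
    convert this using 10
    repeat first | rfl | exact Subsingleton.elim _ _ | congr 1

end CutVertexB1

end MultiGraph

end PercRepro
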